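import Literature.AlgebraicGeometry.HodgeTheory.HolomorphicFormClassPullback
import Literature.AlgebraicGeometry.HodgeTheory.AbelianPencilInvariantCyclesCriteria
import Literature.AlgebraicGeometry.HodgeTheory.HodgeTypeConjugation
import HarnessLib

/-!
# The holomorphic `1`-form of the `(1,0)`-part of a degree-one class, and its naturality

Topic `AlgebraicGeometry/HodgeTheory`.  THEOREMS ONLY about ONE explicit bundled linear map (no new definition, no named fact, no
instance, no notation, no `sorry`):

  `ω_X := oneFormOfClass ∘ Θ_X⁻¹ ∘ (X^an ≃ X(ℂ))^* ∘ π^{1,0} : H¹(X(ℂ); ℂ) →ₗ[ℂ] Ω¹(X^an)`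

for the algebraic-chart Hodge model `A_X := algebraicModel hX` of a smooth projective `X` (★ `AlgebraicChartHodgeModel`; `π^{1,0}` = ★
`HodgeModel.typeProj 1 (1,0)`, `Θ_X` = ★ `HodgeModel.complexification`, ★ `HodgeModel.oneFormOfClass`) — «the holomorphic `1`-form whose class is
the `(1,0)`-component of `c`» ([VoisinHodgeI2002] §6.1.3 Cor. 6.14, §7.1.1 Cor. 7.6: `H¹ = H^{1,0} ⊕ H^{0,1}`, `H^{1,0} ≅ H⁰(Ω¹)`).  We prove: §1 its class IS
the `(1,0)`-part (`holFormClass_oneZeroForm`), it vanishes iff the `(1,0)`-part does, and the `(0,1)`-part is read through conjugation (`c` has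
`π^{1,0} c = 0` and `π^{1,0} c̄ = 0` only if `c = 0`); §2 NATURALITY under any `ℂ`-morphism `f : Y ⟶ X` of smooth projective varieties:
`ω_Y (f(ℂ)^* c) = (f^an)^* (ω_X c)` (★ `typeProj_map_comm` — pull-back preserves Hodge types — and ★ `HolomorphicFormClassPullback.pullback_anMap_eq_oneFormOfClass`
— the class of a pulled-back holomorphic form is the pulled-back class, uniqueness of holomorphic representatives).

Consumer (cell `hodgecm-mathlib`, P5 `F0_AlbCm`, S1-R, M5-rec F1): the realisation of `H¹` of the unitary Shimura curve tower reads a class through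
`ω` on every piece; Hecke equivariance is §2 along the piece morphisms of ★ `UnitaryShimuraCurveHeckeConeTransport`.

## References
* [VoisinHodgeI2002] C. Voisin, *Hodge Theory and Complex Algebraic Geometry I* (2002): §6.1.3 Cor. 6.14, §6.1.3 Cor. 6.12, §7.1.1 Cor. 7.6, §7.3.2.
* [SerreGAGA1956] J.-P. Serre, GAGA (1956), §2 n°5.
-/

noncomputable section

open scoped Manifold TensorProduct
open CategoryTheory
open Literature.Geometry.Kaehler Literature.NumberTheory.Transcendental Literature.AlgebraicTopology.SingularHomology

namespace Literature.AlgebraicGeometry.HodgeTheory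

variable {n m : ℕ} {X Y : Motives.SchemeOver ℂ}

/-- `(1,0)` lies on the antidiagonal of `1` (private index plumbing; any proof serves by proof irrelevance). [folklore] -/
private theorem oneZero_mem_antidiagonal_one' : ((1, 0) : ℕ × ℕ) ∈ Finset.HasAntidiagonal.antidiagonal 1 :=
  Finset.HasAntidiagonal.mem_antidiagonal.2 rfl

/-- `(0,1)` lies on the antidiagonal of `1` (private index plumbing). [folklore] -/
private theorem zeroOne_mem_antidiagonal_one' : ((0, 1) : ℕ × ℕ) ∈ Finset.HasAntidiagonal.antidiagonal 1 :=
  Finset.HasAntidiagonal.mem_antidiagonal.2 rfl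

/-! ### §1 The `(1,0)`-form of a class (any Hodge model `A`) -/

section OneZero

variable (hX : Motives.IsSmoothProjective n X) (A : HodgeModel n X) (hcl : A.HolFormsClosed 1)

/-- The rational-currency class `Θ_X⁻¹ ((π^{1,0} c)|_{X^an})` lies in `Θ_X⁻¹(H^{1,0})`. [cite: VoisinHodgeI2002, §7.1.1] -/
theorem complexification_symm_typeProj_mem_ratPiece (c : complexBetti X 1) :
    (A.complexification hX 1).symm
        (A.pullbackEquiv 1
          (A.typeProj 1 ⟨(1, 0), oneZero_mem_antidiagonal_one'⟩ c)) ∈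
      A.ratPiece hX 1 1 0 := by
  rw [HodgeModel.mem_ratPiece_iff, LinearEquiv.apply_symm_apply, HodgeModel.pullbackEquiv_apply]
  exact (A.mem_typePiece_iff ⟨(1, 0), oneZero_mem_antidiagonal_one'⟩ _).1
    (A.typeProj_mem 1 ⟨(1, 0), oneZero_mem_antidiagonal_one'⟩ c)

/-- **`[ω_X c] = (π^{1,0} c)|_{X^an}`**: the class of the holomorphic `1`-form attached to `c` is the `(1,0)`-part of `c` (read on `X^an`).
[cite: VoisinHodgeI2002, §6.1.3 Cor. 6.14 and §7.1.1 Cor. 7.6] -/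
theorem holFormClass_oneZeroForm (c : complexBetti X 1) :
    A.holFormClass 1 hcl
        (A.oneFormOfClass hX hcl
          ((A.complexification hX 1).symm
            (A.pullbackEquiv 1
              (A.typeProj 1 ⟨(1, 0), oneZero_mem_antidiagonal_one'⟩ c)))) =
      A.pullback 1 (A.typeProj 1 ⟨(1, 0), oneZero_mem_antidiagonal_one'⟩ c) := by
  rw [A.holFormClass_oneFormOfClass_of_mem_ratPiece hX hcl (complexification_symm_typeProj_mem_ratPiece hX A c),
    LinearEquiv.apply_symm_apply, HodgeModel.pullbackEquiv_apply]

/-- The same with the class in the `Θ_X`-currency: `[ω_X c] = Θ_X (Θ_X⁻¹ ((π^{1,0} c)|_{X^an}))`. [cite: VoisinHodgeI2002, §7.1.1 Cor. 7.6] -/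
theorem holFormClass_oneZeroForm' (c : complexBetti X 1) :
    A.holFormClass 1 hcl
        (A.oneFormOfClass hX hcl
          ((A.complexification hX 1).symm
            (A.pullbackEquiv 1
              (A.typeProj 1 ⟨(1, 0), oneZero_mem_antidiagonal_one'⟩ c)))) =
      A.complexification hX 1
        ((A.complexification hX 1).symm
          (A.pullbackEquiv 1
            (A.typeProj 1 ⟨(1, 0), oneZero_mem_antidiagonal_one'⟩ c))) :=
  A.holFormClass_oneFormOfClass_of_mem_ratPiece hX hcl (complexification_symm_typeProj_mem_ratPiece hX A c)

/-- **`ω_X c = 0 ↔ π^{1,0} c = 0`** (the class map is injective on `Θ_X⁻¹(H^{1,0})`). [cite: VoisinHodgeI2002, §7.1.1 Cor. 7.6] -/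
theorem oneZeroForm_eq_zero_iff (c : complexBetti X 1) :
    A.oneFormOfClass hX hcl
          ((A.complexification hX 1).symm
            (A.pullbackEquiv 1
              (A.typeProj 1 ⟨(1, 0), oneZero_mem_antidiagonal_one'⟩ c))) = 0 ↔
      A.typeProj 1 ⟨(1, 0), oneZero_mem_antidiagonal_one'⟩ c = 0 := by
  rw [A.oneFormOfClass_eq_zero_iff_of_mem_ratPiece hX hcl (complexification_symm_typeProj_mem_ratPiece hX A c),
    LinearEquiv.map_eq_zero_iff, LinearEquiv.map_eq_zero_iff]

include hX in
/-- **A degree-one class with vanishing `(1,0)`-part and vanishing `(1,0)`-part of its conjugate is zero** (`H¹ = H^{1,0} ⊕ H^{0,1}` and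
`H^{0,1} = conj H^{1,0}`: `π^{1,0} c̄ = 0` says `c̄ ∈ H^{0,1}`, i.e. `c ∈ H^{1,0}`, so `c = π^{1,0} c = 0`). [cite: VoisinHodgeI2002, §6.1.3 Cor. 6.14 and Cor. 6.12] -/
theorem eq_zero_of_typeProj_oneZero_eq_zero_of_conjClass (c : complexBetti X 1)
    (h10 : A.typeProj 1 ⟨(1, 0), oneZero_mem_antidiagonal_one'⟩ c = 0)
    (h10' : A.typeProj 1 ⟨(1, 0), oneZero_mem_antidiagonal_one'⟩ (conjClass (Motives.ComplexPoints X) 1 c) = 0) :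
    c = 0 := by
  -- `c̄` has no `(1,0)`-part, so `c̄ ∈ H^{0,1}` (two-term decomposition), i.e. `c ∈ H^{1,0}`
  have hsum' := A.sum_typeProj 1 (conjClass (Motives.ComplexPoints X) 1 c)
  have hsum := A.sum_typeProj 1 c
  have huniv : (Finset.univ : Finset ↥(Finset.HasAntidiagonal.antidiagonal 1)) =
      {⟨(1, 0), oneZero_mem_antidiagonal_one'⟩, ⟨(0, 1), zeroOne_mem_antidiagonal_one'⟩} := by
    ext ⟨⟨p, q⟩, hpq⟩
    simp only [Finset.mem_univ, Finset.mem_insert, Finset.mem_singleton, Subtype.mk.injEq, Prod.mk.injEq, true_iff]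
    have h : p + q = 1 := Finset.HasAntidiagonal.mem_antidiagonal.1 hpq
    omega
  have hne : (⟨(1, 0), oneZero_mem_antidiagonal_one'⟩ : ↥(Finset.HasAntidiagonal.antidiagonal 1)) ≠
      ⟨(0, 1), zeroOne_mem_antidiagonal_one'⟩ := by
    intro h; cases h
  rw [huniv, Finset.sum_pair hne] at hsum hsum'
  rw [h10', zero_add] at hsum'
  -- `c̄ ∈ H^{0,1}` ⇒ `c ∈ H^{1,0}` ⇒ `c = π^{1,0} c = 0`
  have h01 : conjClass (Motives.ComplexPoints X) 1 c ∈ A.typePiece 1 ⟨(0, 1), zeroOne_mem_antidiagonal_one'⟩ := by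
    rw [← hsum']
    exact A.typeProj_mem 1 ⟨(0, 1), zeroOne_mem_antidiagonal_one'⟩ _
  have hc10 : c ∈ A.typePiece 1 ⟨(1, 0), oneZero_mem_antidiagonal_one'⟩ := by
    have h01' : A.pullback 1 (conjClass (Motives.ComplexPoints X) 1 c) ∈ A.hodgePQ 1 0 1 :=
      (A.mem_typePiece_iff ⟨(0, 1), zeroOne_mem_antidiagonal_one'⟩ _).1 h01
    rw [← isOfHodgeType_iff_mem_hodgePQ hX A] at h01'
    have h10c : IsOfHodgeType n X 1 1 0 c := (isOfHodgeType_conjClass_iff hX c).1 h01'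
    exact (A.mem_typePiece_iff ⟨(1, 0), oneZero_mem_antidiagonal_one'⟩ c).2 ((isOfHodgeType_iff_mem_hodgePQ hX A c).1 h10c)
  rw [← A.typeProj_apply_of_mem hc10, h10]

end OneZero

/-! ### §2 Naturality: `ω_Y (f(ℂ)^* c) = (f^an)^* (ω_X c)` -/

section Naturality

variable (hX : Motives.IsSmoothProjective n X) (hY : Motives.IsSmoothProjective m Y) (f : Y ⟶ X)
  (hclX : (algebraicModel hX).HolFormsClosed 1) (hclY : (algebraicModel hY).HolFormsClosed 1)

/-- **Naturality of the `(1,0)`-form of a class**: for `f : Y ⟶ X` of smooth projective varieties and `c ∈ H¹(X(ℂ); ℂ)`,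
`ω_Y (f(ℂ)^* c) = (f^an)^* (ω_X c)` as holomorphic `1`-forms on `Y^an` (algebraic-chart models): pull-back commutes with the Hodge
projection (★ `typeProj_map_comm`), with the comparison `(·)|_{X^an}` (★ `HodgeModel.map_anMap_pullback`), and the holomorphic representative
of the pulled-back class is the pulled-back representative (★ `pullback_anMap_eq_oneFormOfClass`). [cite: VoisinHodgeI2002, §6.1.3 Cor. 6.14, §7.1.1 Cor. 7.6 and §7.3.2]
[cite: SerreGAGA1956, §2 n°5] -/
theorem oneZeroForm_map (c : complexBetti X 1) :
    (algebraicModel hY).oneFormOfClass hY hclY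
        (((algebraicModel hY).complexification hY 1).symm
          ((algebraicModel hY).pullbackEquiv 1
            ((algebraicModel hY).typeProj 1 ⟨(1, 0), oneZero_mem_antidiagonal_one'⟩ (complexBetti.map f 1 c)))) =
      ⟨_, pullback_anMap_mem_holFormsInCharts hX hY f
        ((algebraicModel hX).oneFormOfClass hX hclX
          (((algebraicModel hX).complexification hX 1).symm
            ((algebraicModel hX).pullbackEquiv 1
              ((algebraicModel hX).typeProj 1 ⟨(1, 0), oneZero_mem_antidiagonal_one'⟩ c))))⟩ := by
  symm
  refine pullback_anMap_eq_oneFormOfClass hX hY f hclX hclY _ (holFormClass_oneZeroForm' hX (algebraicModel hX) hclX c) ?_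
  -- the pulled-back class in the `Θ`-currency
  rw [LinearEquiv.apply_symm_apply, LinearEquiv.apply_symm_apply, HodgeModel.pullbackEquiv_apply, HodgeModel.pullbackEquiv_apply,
    AbelianPencil.typeProj_map_comm hX hY f (algebraicModel hX) (algebraicModel hY) 1 _ c]
  exact (HodgeModel.map_anMap_pullback (algebraicModel hX) (algebraicModel hY) f 1 _).symm

/-- The same as an identity of bare forms: `↑(ω_Y (f(ℂ)^* c)) = (↑(ω_X c)).pullback (f^an)`. [cite: VoisinHodgeI2002, §7.3.2] -/
theorem coe_oneZeroForm_map (c : complexBetti X 1) :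
    ((algebraicModel hY).oneFormOfClass hY hclY
        (((algebraicModel hY).complexification hY 1).symm
          ((algebraicModel hY).pullbackEquiv 1
            ((algebraicModel hY).typeProj 1 ⟨(1, 0), oneZero_mem_antidiagonal_one'⟩ (complexBetti.map f 1 c)))) :
        MForm 𝓘(ℝ, (algebraicModel hY).model) (algebraicModel hY).carrier ℂ 1) =
      ((algebraicModel hX).oneFormOfClass hX hclX
          (((algebraicModel hX).complexification hX 1).symm
            ((algebraicModel hX).pullbackEquiv 1
              ((algebraicModel hX).typeProj 1 ⟨(1, 0), oneZero_mem_antidiagonal_one'⟩ c))) :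
        MForm 𝓘(ℝ, (algebraicModel hX).model) (algebraicModel hX).carrier ℂ 1).pullback 𝓘(ℝ, (algebraicModel hY).model)
        (HodgeModel.anMap (algebraicModel hX) (algebraicModel hY) f) :=
  congrArg Subtype.val (oneZeroForm_map hX hY f hclX hclY c)

/-- **Conjugation commutes with pull-back of classes** along `f(ℂ)` (★ `conjClass_map`), in the `complexBetti` currency — so the `(0,1)`-half of
the realisation, read as `ω (conj ·)`, is natural too. [cite: VoisinHodgeI2002, §6.1.3 Cor. 6.12] -/
theorem conjClass_complexBetti_map (c : complexBetti X 1) :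
    conjClass (Motives.ComplexPoints Y) 1 (complexBetti.map f 1 c) = complexBetti.map f 1 (conjClass (Motives.ComplexPoints X) 1 c) :=
  conjClass_map _ c

end Naturality

end Literature.AlgebraicGeometry.HodgeTheory

end
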